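import Summits.QuantumFields.YangMills.Theorems.BalabanUVNodesN16HolderWindow
import HarnessLib

/-!
# YM-DAG node N21 (= NE7c), THE IN-EDGE N16 → N21 AT A HÖLDER EXPONENT `β`: the two-run width of the plaquette slot variables
# from the covariant root WITH ITS THIRD CONJUNCT (Lip₂′ᶜ) AT `ξ^{2+β}`, in threshold units `(C_Q∕ε)·(θ^{3β−2})^k`, and road I's
# knit `ShellWeightBound` at explicit carriers with the rate base `θ^{3β−2}` — GEOMETRIC EXACTLY IN THE WINDOW `β > 2∕3` (N19's window)

Track A of `YM-PLAN.md` (cell `pub-ymgap`, HUMAN RULING D-0062), node **N21**; R134 fan-out seat `pub-ymgap-dag-n21-d` (strategy s2 = BY-NAME KNIT),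
generation 4, module 15.  `--supports stmt-QuantumFields-19908` (K3′ `SpineGivenEndpointR12`; helper).  `bears_on: R4∕N21 · in-edge N16 → N21`.
THEOREMS ONLY: 0 `def`, 0 `sorry`, standard axioms; COUNT-NEUTRAL; restate-immune (no Theses import).

WHY THIS FILE (the trigger).  Seat `pub-ymgap-dag-n16-c`'s located item «THE HÖLDER-EXPONENT PIN OF N16's N05-SOCKET»
(`HOME/pub-ymgap-dag-n16-c/LOCATED-N16-HOLDER-PIN.md`; kernel evidence `BalabanUVNodesN16HolderWindow`, p470714): N16's statement of record
`N16At c := NE3EnergyRateWCov 4 (sfClass …) …` carries the (1.36) Hölder member of [Balaban1985RegularSpaces] Theorem 2 at exponent `β = 1`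
(third conjunct «second transported covariant differences of `Z` ≤ `Λ₂′·ξ^3`», `ξ = (L⁻¹)^k`), which print excludes («β ≦ β₀ < 1», p. 82);
the cheap repair R-β restates that conjunct at a printed exponent, `≤ Λ₂′·ξ^{2+β}`.  Their ADDENDUM 1 lists WHO READS (Lip₂′ᶜ): N19 (typed there)
and **N21** — `N21ClosenessJunction.dev_close_of_n16` ∕ `relWidth_of_n16` (n21-a, p410611) and `N21AtKeyedRateHome` §2–§3 (this seat, g2, p463475):
road I's (F∞)-rate binder `ρ_j ≤ c₁ϑ^j` of `n21_knit_levels` is produced from N16 through the plaquette coordinate (Q) `|u^A(p) − u^W(p)| ≤ C_Q·θ^{13k}`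
measured against thresholds `t ≥ ε·(L⁻¹)^{2k}`, i.e. `≤ (C_Q∕ε)·θ^k`, `θ⁶ = L⁻¹` — and says «(C) consumers are their owners'».  THIS FILE is N21's
consumer side: the SAME junction and the SAME knit with the N16 input replaced by the eight-conjunct β-root (n16-c's hypothesis `h` of
`N16HolderWindow.closeness_of_covRoot_holder`, VERBATIM), so that if R-β is adopted nothing on N21's road I is re-typed, and so that the
director's pending ruling «R-β or R-Δ?» (dag-lead open queue) has N21's cost in kernel: the rate base `θ ↦ θ^{3β−2}` and nothing else, for
every `β ∈ (2∕3, 1]`; for `β ≤ 2∕3` the width family is NOT summable (§1), so the window is sharp for road I AS TYPED.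

WHAT IS PROVED ([folklore] real-power arithmetic + applications of landed theorems BY NAME; no decl carries a cite tag).
* §1 THRESHOLD UNITS AT EXPONENT `β`: `relWidth_holder_le` — a width `C·(θ^k)^{10+3β}` against any threshold `t ≥ ε·(L⁻¹)^{2k}` (`ε > 0`) is at most
  `(C∕ε)·(θ^{3β−2})^k` (n16-c's split `(θ^k)^{10+3β} = ((L⁻¹)^k)²·(θ^{3β−2})^k`, `rate_holder_eq_margin_mul`); `holderBase_pos`; `summable_holderWidth`
  (`2∕3 < β`: the family `k ↦ c₁·(θ^{3β−2})^k` is summable — `rate_base_lt_one_of_window`); `eventually_holderWidth_le` (road (δ)'s form);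
  `not_summable_holderWidth_of_le` (`β ≤ 2∕3`, `c₁ ≠ 0` ⇒ NOT summable: `θ^{3β−2} ≥ 1`) and the window as an `iff`, `summable_holderWidth_iff`;
  `rate_holder_one` ∕ `holderBase_one` (`β = 1`: `(θ^k)^{13} = θ^{13k}`, base `θ` — n21-a's file 3 verbatim).
* §2 THE JUNCTION FROM THE β-ROOT at `d = 4` (hypotheses = those of `N21ClosenessJunction.dev_close_of_n16` with `hcov : NE3EnergyRateWCov …` REPLACED by the
  β-root `h` unfolded, eight conjuncts, third at `ξ^{2+β}`, and `β ≤ 2`): `dev_close_of_covRoot_holder` — at every plaquette of run A's lattice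
  `|‖U_A(∂p) − 1‖ − ‖W(∂p) − 1‖| ≤ C_Q·(θ^k)^{10+3β}`, `W = rescale L (bavg L U_B)`, `C_Q = 8l₁√(2γΛ₂′) + 1536l₁⁴γ²e^{8l₁²γ}` (n16-c's
  `closeness_of_covRoot_holder` made gauge-free by n21-a's `dev_close_of_hol_close`); `shell_domination_of_covRoot_holder` (the four mismatch pieces of the
  two runs' sharp indicators at any common threshold lie in single-run shells of that width — `T4IndicatorShell` §3 BY NAME); `relWidth_of_covRoot_holder`
  (the RATE BINDER: `|u^A − u^W|∕t ≤ (C_Q∕ε)·(θ^{3β−2})^k` for `t ≥ ε·(L⁻¹)^{2k}`).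
* §3 INTO FILE 1 BY NAME at the Hölder width: `n21_knit_levels_of_holderWidth` ∕ `…_geometric` — n21-a's `n21_knit_levels` with BOTH runs' level-width
  families SET TO `j ↦ (C_Q∕ε)·(θ^{3β−2})^j`, `2∕3 < β`, `θ⁶ = L⁻¹`, `L ≥ 2`: `ShellWeightBound l₀ T A B shA shB Wsh` for every summable
  `Wsh ≥ 2((N₁+1)ν̄D̄(C_Q∕ε)(θ^{3β−2})^{−N₁})·(θ^{3β−2})^K`, and the closed form itself; the displayed binders are exactly file 3's ([dict] + (M1) = the two
  `LevelLedger`s AT THESE WIDTHS, N20's live windows, `D ≤ D̄`).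

HONEST FRAMING (binding).  The β-root is a HYPOTHESIS — nobody's theorem (N16 ∕ NE3 NOT PRINTED as typed, NOT PROVED); nothing here edits a statement or
rules on R-β ∕ R-Δ ∕ R-min (planner ∕ director business); the `LevelLedger`s ((M1) NOT PRINTED + [dict]), live windows and `D ≤ D̄` are HYPOTHESES, displayed;
nothing of Bałaban's is asserted or instantiated; NODE O's term object untouched; NE7c is NOT PRINTED and NOT PROVED; **N21 is NOT discharged**; typed
28∕28, discharged count untouched; one finite four-torus programme at fixed `ε` — NOT ℝ⁴, NOT infinite volume, NOT OS, NOT a mass gap, NOT Clay.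
-/

set_option autoImplicit false

noncomputable section

open scoped BigOperators Matrix Matrix.Norms.L2Operator
open Finset

namespace Summit.QuantumFields.YangMills.Theorems.N21HolderWidth

open Literature.MathematicalPhysics.QuantumFieldTheory.Balaban1983to89
open B7Prop1Explicit B7Prop2Explicit
open T4IndicatorShell (smallInd largeInd shellBelow shellAbove smallInd_mul_one_sub_le largeInd_mul_one_sub_le abs_sub_comm_le
  ShellWeightBound)
open T4AveragingDeficitWall hiding Site Plane Plaq Bond
open T4AveragingDeficitWallBoundary (periodBox)
open T4ShellMeasureLevels (LevelLedger LiveWindow)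
open Summit.QuantumFields.BalabanUV.T4Continuum
open AveragingDeficitPeriodicCounting (IsPeriodicDir)
open AveragingDeficitDualResidual (dualC1 dualC2)
open AveragingDeficitDerivWallProof (wallConst)
open AveragingDeficitTransport (mem_U1_of_unitary)
open MinimalActionSandwich (IsMinimiser)
open MinimalActionRate (Regular)
open NE3EnergyShapes (residualScale IsUnitarySite IsPeriodicSite)
open NE3EnergyWeightedShapes (energyNormW)
open Summit.QuantumFields.YangMills.Theorems.N21ClosenessJunction (theta_lt_one dev_close_of_hol_close)
open Summit.QuantumFields.YangMills.BalabanUVNodes.N16HolderWindow (closeness_of_covRoot_holder rate_holder_eq_margin_mul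
  rate_base_lt_one_of_window)

/-! ## §1 Threshold units at exponent `β`: the width is `(θ^{3β−2})^k`-small relative to `(L^{−k})²`; the window `β > 2∕3` -/

section Units

/-- The Hölder rate base `θ^{3β−2}` is positive (`θ > 0`). [folklore] -/
theorem holderBase_pos {θ : ℝ} (hθ : 0 < θ) (β : ℝ) : 0 < θ ^ ((3 : ℝ) * β - 2) :=
  Real.rpow_pos_of_pos hθ _

/-- At `β = 1` the base is `θ` itself — n21-a's file 3 (`N21ClosenessJunction`, rate `ϑ = θ = L^{−1∕6}`) verbatim. [folklore] -/
theorem holderBase_one (θ : ℝ) : θ ^ ((3 : ℝ) * 1 - 2) = θ := by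
  rw [show (3 : ℝ) * 1 - 2 = 1 by norm_num, Real.rpow_one]

/-- At `β = 1` the Hölder rate `(θ^k)^{10+3β}` is file 3's `θ^{13k}`. [folklore] -/
theorem rate_holder_one (θ : ℝ) (k : ℕ) : (θ ^ k) ^ ((10 : ℝ) + 3 * 1) = θ ^ (13 * k) := by
  rw [show (10 : ℝ) + 3 * 1 = ((13 : ℕ) : ℝ) by norm_num, Real.rpow_natCast, ← pow_mul, mul_comm]

/-- **RELATIVE WIDTH IN THRESHOLD UNITS AT EXPONENT `β` (generic constant).**  A width `C·(θ^k)^{10+3β}` measured against ANY threshold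
`t ≥ ε·(L⁻¹)^{2k}` (a small-field threshold at least `ε > 0` in units of the squared spacing) is at most `(C∕ε)·(θ^{3β−2})^k` —
LITERALLY the rate shape `ρ_k ≤ c₁ϑ^k` of road I (`hrateA ∕ hrateB` of `n21_knit_levels`) with `c₁ = C∕ε`, `ϑ = θ^{3β−2}`; n16-c's split
`(θ^k)^{10+3β} = ((L⁻¹)^k)²·(θ^{3β−2})^k` (`N16HolderWindow.rate_holder_eq_margin_mul`) does the work. [folklore] -/
theorem relWidth_holder_le {L : ℕ} (hL : 1 ≤ L) {θ : ℝ} (hθ : 0 < θ) (hθ6 : θ ^ 6 = ((L : ℝ))⁻¹) {CQ ε t : ℝ} (hCQ : 0 ≤ CQ)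
    (hε : 0 < ε) (β : ℝ) (k : ℕ) (ht : ε * ((L : ℝ)⁻¹) ^ (2 * k) ≤ t) :
    CQ * (θ ^ k) ^ ((10 : ℝ) + 3 * β) / t ≤ CQ / ε * (θ ^ ((3 : ℝ) * β - 2)) ^ k := by
  have hL0 : (0 : ℝ) < (L : ℝ) := by exact_mod_cast (by omega : 0 < L)
  have hs : 0 < ((L : ℝ)⁻¹) ^ (2 * k) := pow_pos (inv_pos.mpr hL0) _
  have ht0 : 0 < t := lt_of_lt_of_le (mul_pos hε hs) ht
  have hm : (((L : ℝ)⁻¹) ^ k) ^ 2 = ((L : ℝ)⁻¹) ^ (2 * k) := by rw [← pow_mul, mul_comm]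
  have hϑ : 0 ≤ (θ ^ ((3 : ℝ) * β - 2)) ^ k := pow_nonneg (Real.rpow_nonneg hθ.le _) k
  rw [rate_holder_eq_margin_mul hL hθ hθ6 β k, hm, div_le_iff₀ ht0]
  calc CQ * (((L : ℝ)⁻¹) ^ (2 * k) * (θ ^ ((3 : ℝ) * β - 2)) ^ k)
      = CQ / ε * (θ ^ ((3 : ℝ) * β - 2)) ^ k * (ε * ((L : ℝ)⁻¹) ^ (2 * k)) := by
        field_simp
    _ ≤ CQ / ε * (θ ^ ((3 : ℝ) * β - 2)) ^ k * t :=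
        mul_le_mul_of_nonneg_left ht (mul_nonneg (div_nonneg hCQ hε.le) hϑ)

/-- **THE WINDOW, SUMMABLE SIDE.**  For `2∕3 < β` the Hölder width family `k ↦ c₁·(θ^{3β−2})^k` is SUMMABLE (`θ⁶ = L⁻¹`, `L ≥ 2`, so `0 < θ < 1` and
`0 < θ^{3β−2} < 1` by n16-c's `rate_base_lt_one_of_window`) — the currency `Summable ρ` of the band twins. [folklore] -/
theorem summable_holderWidth {L : ℕ} (hL : 2 ≤ L) {θ : ℝ} (hθ : 0 < θ) (hθ6 : θ ^ 6 = ((L : ℝ))⁻¹) {β : ℝ} (hβ : 2 / 3 < β)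
    (c₁ : ℝ) : Summable fun k : ℕ => c₁ * (θ ^ ((3 : ℝ) * β - 2)) ^ k :=
  (summable_geometric_of_lt_one (Real.rpow_nonneg hθ.le _)
    (rate_base_lt_one_of_window hθ (theta_lt_one hL hθ6) hβ)).mul_left c₁

/-- **EVENTUAL SMALLNESS** in the window (road (δ)'s `LiveFactorEventually` form): for `2∕3 < β` and every `β′ > 0` the width `c₁·(θ^{3β−2})^k` is
`≤ β′` from some level on. [folklore] -/
theorem eventually_holderWidth_le {L : ℕ} (hL : 2 ≤ L) {θ : ℝ} (hθ : 0 < θ) (hθ6 : θ ^ 6 = ((L : ℝ))⁻¹) {β : ℝ} (hβ : 2 / 3 < β)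
    (c₁ : ℝ) {β' : ℝ} (hβ' : 0 < β') : ∃ k₀ : ℕ, ∀ k, k₀ ≤ k → c₁ * (θ ^ ((3 : ℝ) * β - 2)) ^ k ≤ β' := by
  have hlim : Filter.Tendsto (fun k : ℕ => c₁ * (θ ^ ((3 : ℝ) * β - 2)) ^ k) Filter.atTop (nhds 0) := by
    simpa using (tendsto_pow_atTop_nhds_zero_of_lt_one (Real.rpow_nonneg hθ.le _)
      (rate_base_lt_one_of_window hθ (theta_lt_one hL hθ6) hβ)).const_mul c₁
  obtain ⟨k₀, hk₀⟩ := Filter.eventually_atTop.mp ((tendsto_order.mp hlim).2 β' hβ')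
  exact ⟨k₀, fun k hk => (hk₀ k hk).le⟩

/-- **THE WINDOW, DIVERGENT SIDE — it is sharp for road I as typed.**  For `β ≤ 2∕3` the base is `θ^{3β−2} ≥ 1` (`0 < θ < 1`, exponent `≤ 0`), so a
width family `k ↦ c₁·(θ^{3β−2})^k` with `c₁ ≠ 0` is NOT summable: road I's rate binder `ρ_j ≤ c₁ϑ^j`, `ϑ < 1`, has no producer from a Hölder
member at exponent `β ≤ 2∕3` through this route. [folklore] -/
theorem not_summable_holderWidth_of_le {L : ℕ} (hL : 2 ≤ L) {θ : ℝ} (hθ : 0 < θ) (hθ6 : θ ^ 6 = ((L : ℝ))⁻¹) {β : ℝ}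
    (hβ : β ≤ 2 / 3) {c₁ : ℝ} (hc : c₁ ≠ 0) : ¬ Summable fun k : ℕ => c₁ * (θ ^ ((3 : ℝ) * β - 2)) ^ k := by
  intro hs
  have h1 : 1 ≤ θ ^ ((3 : ℝ) * β - 2) :=
    Real.one_le_rpow_of_pos_of_le_one_of_nonpos hθ (theta_lt_one hL hθ6).le (by linarith)
  have h2 := summable_geometric_iff_norm_lt_one.1 ((summable_mul_left_iff hc).1 hs)
  rw [Real.norm_of_nonneg (Real.rpow_nonneg hθ.le _)] at h2
  linarith

/-- **THE WINDOW AS AN `iff`**: for `c₁ ≠ 0` the Hölder width family `k ↦ c₁·(θ^{3β−2})^k` is summable iff `2∕3 < β`. [folklore] -/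
theorem summable_holderWidth_iff {L : ℕ} (hL : 2 ≤ L) {θ : ℝ} (hθ : 0 < θ) (hθ6 : θ ^ 6 = ((L : ℝ))⁻¹) (β : ℝ) {c₁ : ℝ}
    (hc : c₁ ≠ 0) : (Summable fun k : ℕ => c₁ * (θ ^ ((3 : ℝ) * β - 2)) ^ k) ↔ 2 / 3 < β := by
  refine ⟨fun hs => ?_, fun hβ => summable_holderWidth hL hθ hθ6 hβ c₁⟩
  by_contra hβ
  exact not_summable_holderWidth_of_le hL hθ hθ6 (not_lt.1 hβ) hc hs

end Units

/-! ## §2 THE JUNCTION at `d = 4` FROM THE β-ROOT: the two-run width of the plaquette slot variables at rate `(θ^k)^{10+3β}` -/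

section Junction

variable {n : Type*} [Fintype n] [DecidableEq n] [Nonempty n]
  {𝒞 : ℕ → Set (Site 4 → Fin 4 → (Matrix n n ℂ)ˣ)} {L N : ℕ} {θ b g C Λ₁ Λ₂' β γ l₁ : ℝ}
  {dom : Set (Site 4 → Fin 4 → (Matrix n n ℂ)ˣ)} {k : ℕ} {V UA UB : Site 4 → Fin 4 → (Matrix n n ℂ)ˣ}

/-- **THE N16 ⊗ N21 JUNCTION AT HÖLDER EXPONENT `β`.**  HYPOTHESES: the β-ROOT `h` — N16's covariant root `NE3EnergyRateWCov 4 𝒞 L N b g C Λ₁ Λ₂′ dom`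
UNFOLDED with its third conjunct (Lip₂′ᶜ) restated at exponent `β` (`≤ Λ₂′·ξ^{2+β}`; everything else token for token; n16-c's hypothesis of
`N16HolderWindow.closeness_of_covRoot_holder` VERBATIM — NOT PRINTED as a whole, NOT PROVED, nobody's theorem), `β ≤ 2`, and the side letters of the
consumer END (`L ≥ 2`, `N ≥ 1`, `θ⁶ = L⁻¹`, class data `b, g`, budget `γ` with `C·ρ₄ ≤ γ³`, cube root `l₁` of `Λ₁`, `Λ₂′ > 0`, a level `k ≥ 1` past the
fit `γ(θ^k)² ≤ l₁N`, a datum `V ∈ dom`, run A's minimiser `U_A` at level `k`, run B's `U_B` at level `k+1`, regular).  CONCLUSION: at EVERY plaquette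
of run A's lattice the slot variables `u^A = ‖U_A(∂p) − 1‖` and `u^W = ‖W(∂p) − 1‖`, `W = rescale L (bavg L U_B)`, differ by at most
`C_Q·(θ^k)^{10+3β}`, `C_Q = 8l₁√(2γΛ₂′) + 1536l₁⁴γ²e^{8l₁²γ}` — (Q) of `closeness_of_covRoot_holder` made gauge-free by n21-a's `dev_close_of_hol_close`
([Balaban1985Averaging] (45): deviations are gauge invariant).  `β = 1` is `N21ClosenessJunction.dev_close_of_n16` (`rate_holder_one`). [folklore] -/
theorem dev_close_of_covRoot_holder (hL : 2 ≤ L) (hN : 1 ≤ N) (hθ : 0 < θ) (hθ6 : θ ^ 6 = ((L : ℝ))⁻¹) (hb : 0 ≤ b)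
    (hbs : 512 * (4 + 1) * (4 + 4) * (L : ℝ) ^ 2 * b ≤ 1) (hg : 0 ≤ g) (hC : 0 ≤ C) (hΛ₂' : 0 < Λ₂') (hβ2 : β ≤ 2)
    (h : ∀ k : ℕ, 1 ≤ k → ∀ V ∈ dom, ∀ UA UB : Site 4 → Fin 4 → (Matrix n n ℂ)ˣ,
      IsMinimiser 4 𝒞 L N k V UA → IsMinimiser 4 𝒞 L N (k + 1) V UB → Regular 4 L N b g (k + 1) UB →
        ∃ (u : Site 4 → (Matrix n n ℂ)ˣ) (Z : Site 4 → Fin 4 → Matrix n n ℂ),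
          IsUnitarySite u ∧ IsPeriodicSite u ((N * L ^ k : ℕ) : ℤ) ∧
          IsSkewDir Z ∧ IsPeriodicDir Z ((N * L ^ k : ℕ) : ℤ) ∧
          gaugeAct u UA = vary (rescale L (bavg L UB)) Z 1 ∧
          energyNormW L k (rescale L (bavg L UB)) Z (periodBox (N * L ^ k)) ≤ C * residualScale 4 L N b g k ∧
          (∀ (κ : Fin 4) (x : Site 4) (μ : Fin 4),
            ‖Ad (rescale L (bavg L UB) (x + e κ) μ) (Z (x + e μ) κ) - Z x κ‖ ≤ Λ₁ * (((L : ℝ)⁻¹) ^ k) ^ 2) ∧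
          (∀ (κ μ : Fin 4) (y : Site 4),
            ‖Ad (rescale L (bavg L UB) (y + e κ) μ)
                (Ad (rescale L (bavg L UB) (y + e κ + e μ) μ) (Z (y + (2 : ℕ) • e μ) κ) - Z (y + e μ) κ)
              - (Ad (rescale L (bavg L UB) (y + e κ) μ) (Z (y + e μ) κ) - Z y κ)‖ ≤ Λ₂' * (((L : ℝ)⁻¹) ^ k) ^ ((2 : ℝ) + β)))
    (hγ : 0 < γ) (hγ3 : C * (wallConst 4 L * (N : ℝ) ^ 2 * (Real.sqrt g * dualC2 4 L + 2 * b ^ 2 * dualC1 4 L)) ≤ γ ^ 3)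
    (hl₁ : 0 < l₁) (hΛl₁ : Λ₁ ≤ l₁ ^ 3) (hk : 1 ≤ k) (hfit : γ * (θ ^ k) ^ 2 ≤ l₁ * N) (hV : V ∈ dom)
    (hA : IsMinimiser 4 𝒞 L N k V UA) (hB : IsMinimiser 4 𝒞 L N (k + 1) V UB) (hreg : Regular 4 L N b g (k + 1) UB)
    (z : Site 4) (μ ν : Fin 4) :
    |‖((hol UA z (plaqWord μ ν) : (Matrix n n ℂ)ˣ) : Matrix n n ℂ) - 1‖
        - ‖((hol (rescale L (bavg L UB)) z (plaqWord μ ν) : (Matrix n n ℂ)ˣ) : Matrix n n ℂ) - 1‖|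
      ≤ (8 * l₁ * Real.sqrt (2 * γ * Λ₂') + 1536 * l₁ ^ 4 * γ ^ 2 * Real.exp (8 * l₁ ^ 2 * γ))
          * (θ ^ k) ^ ((10 : ℝ) + 3 * β) := by
  obtain ⟨u, Z, hu, -, -, -, -, -, -, -, hQ⟩ :=
    closeness_of_covRoot_holder hL hN hθ hθ6 hb hbs hg hC hΛ₂' hβ2 h hγ hγ3 hl₁ hΛl₁ hk hfit hV hA hB hreg
  exact dev_close_of_hol_close (fun x => mem_U1_of_unitary (hu x)) hQ z μ ν

/-- **SHELL DOMINATION FROM THE β-ROOT.**  Under the hypotheses of `dev_close_of_covRoot_holder`, at every plaquette slot and EVERY common threshold `t`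
the four mismatch pieces of the two runs' sharp indicators lie in single-run shells of width `C_Q·(θ^k)^{10+3β}` (`T4IndicatorShell` §3 BY NAME at the
Hölder width) — the `cover` step of every N21 ledger per plaquette. [folklore] -/
theorem shell_domination_of_covRoot_holder (hL : 2 ≤ L) (hN : 1 ≤ N) (hθ : 0 < θ) (hθ6 : θ ^ 6 = ((L : ℝ))⁻¹) (hb : 0 ≤ b)
    (hbs : 512 * (4 + 1) * (4 + 4) * (L : ℝ) ^ 2 * b ≤ 1) (hg : 0 ≤ g) (hC : 0 ≤ C) (hΛ₂' : 0 < Λ₂') (hβ2 : β ≤ 2)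
    (h : ∀ k : ℕ, 1 ≤ k → ∀ V ∈ dom, ∀ UA UB : Site 4 → Fin 4 → (Matrix n n ℂ)ˣ,
      IsMinimiser 4 𝒞 L N k V UA → IsMinimiser 4 𝒞 L N (k + 1) V UB → Regular 4 L N b g (k + 1) UB →
        ∃ (u : Site 4 → (Matrix n n ℂ)ˣ) (Z : Site 4 → Fin 4 → Matrix n n ℂ),
          IsUnitarySite u ∧ IsPeriodicSite u ((N * L ^ k : ℕ) : ℤ) ∧
          IsSkewDir Z ∧ IsPeriodicDir Z ((N * L ^ k : ℕ) : ℤ) ∧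
          gaugeAct u UA = vary (rescale L (bavg L UB)) Z 1 ∧
          energyNormW L k (rescale L (bavg L UB)) Z (periodBox (N * L ^ k)) ≤ C * residualScale 4 L N b g k ∧
          (∀ (κ : Fin 4) (x : Site 4) (μ : Fin 4),
            ‖Ad (rescale L (bavg L UB) (x + e κ) μ) (Z (x + e μ) κ) - Z x κ‖ ≤ Λ₁ * (((L : ℝ)⁻¹) ^ k) ^ 2) ∧
          (∀ (κ μ : Fin 4) (y : Site 4),
            ‖Ad (rescale L (bavg L UB) (y + e κ) μ)
                (Ad (rescale L (bavg L UB) (y + e κ + e μ) μ) (Z (y + (2 : ℕ) • e μ) κ) - Z (y + e μ) κ)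
              - (Ad (rescale L (bavg L UB) (y + e κ) μ) (Z (y + e μ) κ) - Z y κ)‖ ≤ Λ₂' * (((L : ℝ)⁻¹) ^ k) ^ ((2 : ℝ) + β)))
    (hγ : 0 < γ) (hγ3 : C * (wallConst 4 L * (N : ℝ) ^ 2 * (Real.sqrt g * dualC2 4 L + 2 * b ^ 2 * dualC1 4 L)) ≤ γ ^ 3)
    (hl₁ : 0 < l₁) (hΛl₁ : Λ₁ ≤ l₁ ^ 3) (hk : 1 ≤ k) (hfit : γ * (θ ^ k) ^ 2 ≤ l₁ * N) (hV : V ∈ dom)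
    (hA : IsMinimiser 4 𝒞 L N k V UA) (hB : IsMinimiser 4 𝒞 L N (k + 1) V UB) (hreg : Regular 4 L N b g (k + 1) UB)
    (z : Site 4) (μ ν : Fin 4) (t : ℝ) :
    let uA : ℝ := ‖((hol UA z (plaqWord μ ν) : (Matrix n n ℂ)ˣ) : Matrix n n ℂ) - 1‖
    let uW : ℝ := ‖((hol (rescale L (bavg L UB)) z (plaqWord μ ν) : (Matrix n n ℂ)ˣ) : Matrix n n ℂ) - 1‖
    let Δ : ℝ := (8 * l₁ * Real.sqrt (2 * γ * Λ₂') + 1536 * l₁ ^ 4 * γ ^ 2 * Real.exp (8 * l₁ ^ 2 * γ))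
      * (θ ^ k) ^ ((10 : ℝ) + 3 * β)
    smallInd uA t * (1 - smallInd uW t) ≤ shellBelow uA t Δ ∧
      smallInd uW t * (1 - smallInd uA t) ≤ shellBelow uW t Δ ∧
      largeInd uA t * (1 - largeInd uW t) ≤ shellAbove uA t Δ ∧
      largeInd uW t * (1 - largeInd uA t) ≤ shellAbove uW t Δ := by
  have hc := dev_close_of_covRoot_holder hL hN hθ hθ6 hb hbs hg hC hΛ₂' hβ2 h hγ hγ3 hl₁ hΛl₁ hk hfit hV hA hB hreg z μ ν
  exact ⟨smallInd_mul_one_sub_le hc, smallInd_mul_one_sub_le (abs_sub_comm_le hc),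
    largeInd_mul_one_sub_le hc, largeInd_mul_one_sub_le (abs_sub_comm_le hc)⟩

/-- **THE (F∞) RATE BINDER PRODUCED FROM THE β-ROOT.**  Under the hypotheses of `dev_close_of_covRoot_holder` and for any threshold `t ≥ ε·(L⁻¹)^{2k}`
(`ε > 0`), the RELATIVE two-run width of every plaquette slot variable at level `k` is at most `(C_Q∕ε)·(θ^{3β−2})^k` — road I's binder
«ρ_j ≤ c₁ϑ^j» with the EXPLICIT letters `c₁ = C_Q∕ε`, `ϑ = θ^{3β−2}` (in `(0,1)` iff `β > 2∕3`, §1).  CONDITIONAL on the β-root. [folklore] -/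
theorem relWidth_of_covRoot_holder (hL : 2 ≤ L) (hN : 1 ≤ N) (hθ : 0 < θ) (hθ6 : θ ^ 6 = ((L : ℝ))⁻¹) (hb : 0 ≤ b)
    (hbs : 512 * (4 + 1) * (4 + 4) * (L : ℝ) ^ 2 * b ≤ 1) (hg : 0 ≤ g) (hC : 0 ≤ C) (hΛ₂' : 0 < Λ₂') (hβ2 : β ≤ 2)
    (h : ∀ k : ℕ, 1 ≤ k → ∀ V ∈ dom, ∀ UA UB : Site 4 → Fin 4 → (Matrix n n ℂ)ˣ,
      IsMinimiser 4 𝒞 L N k V UA → IsMinimiser 4 𝒞 L N (k + 1) V UB → Regular 4 L N b g (k + 1) UB →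
        ∃ (u : Site 4 → (Matrix n n ℂ)ˣ) (Z : Site 4 → Fin 4 → Matrix n n ℂ),
          IsUnitarySite u ∧ IsPeriodicSite u ((N * L ^ k : ℕ) : ℤ) ∧
          IsSkewDir Z ∧ IsPeriodicDir Z ((N * L ^ k : ℕ) : ℤ) ∧
          gaugeAct u UA = vary (rescale L (bavg L UB)) Z 1 ∧
          energyNormW L k (rescale L (bavg L UB)) Z (periodBox (N * L ^ k)) ≤ C * residualScale 4 L N b g k ∧
          (∀ (κ : Fin 4) (x : Site 4) (μ : Fin 4),
            ‖Ad (rescale L (bavg L UB) (x + e κ) μ) (Z (x + e μ) κ) - Z x κ‖ ≤ Λ₁ * (((L : ℝ)⁻¹) ^ k) ^ 2) ∧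
          (∀ (κ μ : Fin 4) (y : Site 4),
            ‖Ad (rescale L (bavg L UB) (y + e κ) μ)
                (Ad (rescale L (bavg L UB) (y + e κ + e μ) μ) (Z (y + (2 : ℕ) • e μ) κ) - Z (y + e μ) κ)
              - (Ad (rescale L (bavg L UB) (y + e κ) μ) (Z (y + e μ) κ) - Z y κ)‖ ≤ Λ₂' * (((L : ℝ)⁻¹) ^ k) ^ ((2 : ℝ) + β)))
    (hγ : 0 < γ) (hγ3 : C * (wallConst 4 L * (N : ℝ) ^ 2 * (Real.sqrt g * dualC2 4 L + 2 * b ^ 2 * dualC1 4 L)) ≤ γ ^ 3)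
    (hl₁ : 0 < l₁) (hΛl₁ : Λ₁ ≤ l₁ ^ 3) (hk : 1 ≤ k) (hfit : γ * (θ ^ k) ^ 2 ≤ l₁ * N) (hV : V ∈ dom)
    (hA : IsMinimiser 4 𝒞 L N k V UA) (hB : IsMinimiser 4 𝒞 L N (k + 1) V UB) (hreg : Regular 4 L N b g (k + 1) UB)
    {ε t : ℝ} (hε : 0 < ε) (ht : ε * ((L : ℝ)⁻¹) ^ (2 * k) ≤ t) (z : Site 4) (μ ν : Fin 4) :
    |‖((hol UA z (plaqWord μ ν) : (Matrix n n ℂ)ˣ) : Matrix n n ℂ) - 1‖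
        - ‖((hol (rescale L (bavg L UB)) z (plaqWord μ ν) : (Matrix n n ℂ)ˣ) : Matrix n n ℂ) - 1‖| / t
      ≤ (8 * l₁ * Real.sqrt (2 * γ * Λ₂') + 1536 * l₁ ^ 4 * γ ^ 2 * Real.exp (8 * l₁ ^ 2 * γ)) / ε
          * (θ ^ ((3 : ℝ) * β - 2)) ^ k := by
  have hL0 : (0 : ℝ) < (L : ℝ) := by exact_mod_cast (by omega : 0 < L)
  have ht0 : 0 < t := lt_of_lt_of_le (mul_pos hε (pow_pos (inv_pos.mpr hL0) _)) ht
  have hCQ : 0 ≤ 8 * l₁ * Real.sqrt (2 * γ * Λ₂') + 1536 * l₁ ^ 4 * γ ^ 2 * Real.exp (8 * l₁ ^ 2 * γ) := by positivity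
  have hc := dev_close_of_covRoot_holder hL hN hθ hθ6 hb hbs hg hC hΛ₂' hβ2 h hγ hγ3 hl₁ hΛl₁ hk hfit hV hA hB hreg z μ ν
  calc _ ≤ (8 * l₁ * Real.sqrt (2 * γ * Λ₂') + 1536 * l₁ ^ 4 * γ ^ 2 * Real.exp (8 * l₁ ^ 2 * γ))
          * (θ ^ k) ^ ((10 : ℝ) + 3 * β) / t :=
        div_le_div_of_nonneg_right hc ht0.le
    _ ≤ _ := relWidth_holder_le (by omega : 1 ≤ L) hθ hθ6 hCQ hε β k ht

end Junction

/-! ## §3 Into file 1 BY NAME: road I's knit with both width families set to the Hölder width, in the window `β > 2∕3` -/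

section IntoKnit

variable {ι σA σB : Type*} {l₀ : ℝ} {T : ℕ → Finset ι} {A B shA shB : ℕ → ℝ → ι → ℝ}
  {SA : ℕ → Finset σA} {SB : ℕ → Finset σB} {pieceA : ℕ → ℝ → σA → ι → ℝ} {pieceB : ℕ → ℝ → σB → ι → ℝ}
  {lvlA : ℕ → σA → ℕ} {lvlB : ℕ → σB → ℕ} {DA DB : ℕ → ℝ} {N₁ : ℕ} {νbar Dbar : ℝ}

/-- **ROAD I AT THE HÖLDER WIDTH.**  n21-a's knit `n21_knit_levels` (file 1, p408928) with BOTH runs' level-width families SET TO the Hölder width in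
threshold units `j ↦ (C_Q∕ε)·(θ^{3β−2})^j` (§2; `C_Q` any real here), `θ⁶ = L⁻¹`, `L ≥ 2`, IN THE WINDOW `2∕3 < β`: its rate binders `hrateA`, `hrateB`
DISCHARGE by `le_rfl` and `0 < ϑ = θ^{3β−2} < 1` by §1; the remaining displayed binders are exactly file 3's — [dict] + (M1) = the two `LevelLedger`s
AT THESE WIDTHS (`cover` supplied per plaquette by §2; `slot` = THE WALL (M1) by level), N20's live windows, and `D ≤ D̄`.  CONCLUSION:
`ShellWeightBound l₀ T A B shA shB Wsh` for every summable `Wsh ≥ 2((N₁+1)ν̄D̄(C_Q∕ε)(θ^{3β−2})^{−N₁})·(θ^{3β−2})^K`.  At `β = 1` this is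
`N21ClosenessJunction.n21_knit_levels_of_n16Width` (`holderBase_one`).  NE7c NOT proved. [folklore] -/
theorem n21_knit_levels_of_holderWidth {L : ℕ} (hL : 2 ≤ L) {θ : ℝ} (hθ : 0 < θ) (hθ6 : θ ^ 6 = ((L : ℝ))⁻¹) {β : ℝ}
    (hβ : 2 / 3 < β) (CQ ε : ℝ)
    (hA : LevelLedger l₀ T A shA SA pieceA lvlA DA (fun j => CQ / ε * (θ ^ ((3 : ℝ) * β - 2)) ^ j))
    (hB : LevelLedger l₀ T B shB SB pieceB lvlB DB (fun j => CQ / ε * (θ ^ ((3 : ℝ) * β - 2)) ^ j))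
    (hwA : LiveWindow SA lvlA N₁ νbar) (hwB : LiveWindow SB lvlB N₁ νbar)
    (hDA : ∀ j, DA j ≤ Dbar) (hDB : ∀ j, DB j ≤ Dbar)
    {Wsh : ℕ → ℝ}
    (hWsh : ∀ K, (2 * ((N₁ + 1) * νbar * Dbar * (CQ / ε) * (θ ^ ((3 : ℝ) * β - 2))⁻¹ ^ N₁))
      * (θ ^ ((3 : ℝ) * β - 2)) ^ K ≤ Wsh K)
    (hsum : Summable Wsh) : ShellWeightBound l₀ T A B shA shB Wsh :=
  n21_knit_levels hA hB hwA hwB hDA hDB (holderBase_pos hθ β) (rate_base_lt_one_of_window hθ (theta_lt_one hL hθ6) hβ)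
    (fun _ => le_rfl) (fun _ => le_rfl) hWsh hsum

/-- … and the closed form: the geometric weight `2((N₁+1)ν̄D̄(C_Q∕ε)(θ^{3β−2})^{−N₁})·(θ^{3β−2})^K` ITSELF is a shell-weight bound at the Hölder width
in the window `2∕3 < β` (`n21_knit_levels_geometric`). [folklore] -/
theorem n21_knit_levels_of_holderWidth_geometric {L : ℕ} (hL : 2 ≤ L) {θ : ℝ} (hθ : 0 < θ) (hθ6 : θ ^ 6 = ((L : ℝ))⁻¹)
    {β : ℝ} (hβ : 2 / 3 < β) (CQ ε : ℝ)
    (hA : LevelLedger l₀ T A shA SA pieceA lvlA DA (fun j => CQ / ε * (θ ^ ((3 : ℝ) * β - 2)) ^ j))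
    (hB : LevelLedger l₀ T B shB SB pieceB lvlB DB (fun j => CQ / ε * (θ ^ ((3 : ℝ) * β - 2)) ^ j))
    (hwA : LiveWindow SA lvlA N₁ νbar) (hwB : LiveWindow SB lvlB N₁ νbar)
    (hDA : ∀ j, DA j ≤ Dbar) (hDB : ∀ j, DB j ≤ Dbar) :
    ShellWeightBound l₀ T A B shA shB
      fun K => (2 * ((N₁ + 1) * νbar * Dbar * (CQ / ε) * (θ ^ ((3 : ℝ) * β - 2))⁻¹ ^ N₁)) * (θ ^ ((3 : ℝ) * β - 2)) ^ K :=
  n21_knit_levels_geometric hA hB hwA hwB hDA hDB (holderBase_pos hθ β)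
    (rate_base_lt_one_of_window hθ (theta_lt_one hL hθ6) hβ) (fun _ => le_rfl) (fun _ => le_rfl)

end IntoKnit

end Summit.QuantumFields.YangMills.Theorems.N21HolderWidth

end
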